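import Summits.BirchSwinnertonDyer.BirchSwinnertonDyer.Theorems.ManinLocalTwoThreeMinimalCubeRootIntegral
import Summits.BirchSwinnertonDyer.Rank1Residual.ManinAdditive.UDCKummerLineK
import HarnessLib

/-!
# (INT)_K, the case of a RATIONAL point: reduction to the integral minimal cube root of p3 g15
(route `ManinLocalTwoThree`, crux C3 `ManinPrimeToThreeAtNine` stmt-BirchSwinnertonDyer-22968; cell bsd-f2-manin, prover seat p3 gen 16 —
piece (INT)_K of -an g39's `K`-rational UDC line `UDCKummerLineK`, p2 g18's interface; `--supports` 22968)

When the `K`-point `T = (X₀, Y₀)` of an's (AN)_K has `Y₀ = y ∈ ℚ`, the data of the `K`-line are the data of the `ℚ`-line read in `ℂ`: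
`IsShortThreeTorsionC ⟹ IsShortThreeTorsion` (`map_nonsingular`), `kummerCubeSeriesC = map kummerCubeSeries`, the complex cube root `h`
IS the rational one (`cubeRoot_unique`), and `IsThreeAdicallyBoundedAlg h ⟹ IsThreeAdicallyBounded h_ℚ` (an algebraic integer in `ℚ` is an
integer).  Then p3 g15's `MinimalCubeRoot.exists_int_minimalCubeRoot` gives the INTEGER renormalised cube root `g`, so (INT)_K holds with
`K' = 0` in this case:

* `exists_algInt_minimalCubeRootC_of_ratCast` — (INT)_K's conclusion `∃ g K', (∀ n, IsIntegral ℤ (3^K'·gₙ)) ∧ g(0) = −1 ∧ c·(z·g) = z_W·h`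
  for `Y₀ = (y : ℚ)`.

HONEST FRAMING.  The case `Y₀ ∉ ℚ` (the one RES₃♭ needs: `μ₃`-type and generic `K`-points) is NOT treated here (pieces K1–K4b landed:
`…AlgIntCubeRoot`, `…MinimalThreeTorsionAlgInt`, `…KummerCubeSeriesCTransport`, `…CubeRootComponents`, `…CubeSystemDescent`; assembly pending).
Nothing about C3, Manin's conjecture or BSD is proved here.  No definitions, no sorry.
[cite: SilvermanAEC2009, VII.3.4 and IV.1 (shape; the content is p3 g15's theorem)]
-/

set_option autoImplicit false
-- lint-debt: the directory name repeats the summit name (sibling precedent `ManinLocalTwoThreeMinimalCubeRootIntegral.lean`)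
set_option linter.dupNamespace false

noncomputable section

open scoped Classical
open PowerSeries WeierstrassCurve Literature.NumberTheory.EllipticCurves Literature.NumberTheory.EllipticCurves.ModularForms
open Summit.BirchSwinnertonDyer.Rank1Residual.ManinAdditive.CuspidalKummer
open Summit.BirchSwinnertonDyer.Rank1Residual.ManinAdditive.CuspidalKummerThree
open Summit.BirchSwinnertonDyer.Rank1Residual.ManinAdditive.UDCKummerLine
open Summit.BirchSwinnertonDyer.Rank1Residual.ManinAdditive.UDCKummerLineK
open Summit.BirchSwinnertonDyer.BirchSwinnertonDyer.Theorems.ManinLocalTwoThree.KummerCubeRootBounded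
  (cubeRoot_unique exists_cubeRoot_of_constantCoeff_eq_neg_one)

namespace Summit.BirchSwinnertonDyer.BirchSwinnertonDyer.Theorems.ManinLocalTwoThree.MinimalCubeRootC

/-! ## §1 The `K`-data at a rational point are the `ℚ`-data -/

/-- `IsShortThreeTorsionC W c X₀ (y : ℂ) ⟹ IsShortThreeTorsion W c X₀ y`. [folklore] -/
theorem isShortThreeTorsion_of_ratCast {W : WeierstrassCurve ℚ} {c : ℤ} {X₀ y : ℚ} (hT : IsShortThreeTorsionC W c X₀ (y : ℂ)) :
    IsShortThreeTorsion W c X₀ y := by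
  refine ⟨?_, hT.2⟩
  have h := hT.1
  have e : ((shortModel W c).map (algebraMap ℚ ℂ)).toAffine.Nonsingular (algebraMap ℚ ℂ X₀) (algebraMap ℚ ℂ y) := h
  exact (Affine.map_nonsingular (W := (shortModel W c).toAffine) (algebraMap ℚ ℂ).injective X₀ y).mp e

/-- `tangentSlopeC` at a rational point is the rational `tangentSlope`. [folklore] -/
theorem tangentSlopeC_ratCast (W : WeierstrassCurve ℚ) (c : ℤ) (X₀ y : ℚ) :
    tangentSlopeC W c X₀ (y : ℂ) = (tangentSlope W c X₀ y : ℂ) := by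
  rw [tangentSlopeC, tangentSlope]; push_cast; rfl

/-- `kummerCubeSeriesC` at a rational point is the image of the rational `kummerCubeSeries`. [folklore] -/
theorem kummerCubeSeriesC_ratCast (W : WeierstrassCurve ℚ) (c : ℤ) (X₀ y : ℚ) (z : ℚ⟦X⟧) :
    kummerCubeSeriesC W c X₀ (y : ℂ) z = PowerSeries.map (algebraMap ℚ ℂ) (kummerCubeSeries W c X₀ y z) := by
  rw [kummerCubeSeriesC, kummerCubeSeries, tangentSlopeC_ratCast]
  simp only [smul_eq_C_mul, map_sub, map_mul, map_pow, PowerSeries.map_C, eq_ratCast]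

/-- An element of `ℚ` that is integral over `ℤ` (read in `ℂ`) is an integer. [folklore] -/
theorem exists_intCast_eq_of_isIntegral {q : ℚ} (hq : IsIntegral ℤ ((q : ℚ) : ℂ)) : ∃ m : ℤ, (m : ℚ) = q := by
  have hq' : IsIntegral ℤ q :=
    (isIntegral_algHom_iff ((algebraMap ℚ ℂ).toIntAlgHom) (algebraMap ℚ ℂ).injective).mp hq
  obtain ⟨m, hm⟩ := IsIntegrallyClosed.isIntegral_iff.mp hq'
  exact ⟨m, by simpa using hm⟩

/-- `M·q ∈ ℤ` with `3 ∤ M` ⟹ `‖q‖₃ ≤ 1`. [folklore] -/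
theorem norm_le_one_of_mul_int {q : ℚ} {M : ℕ} (hM : ¬ 3 ∣ M) {m : ℤ} (h : (m : ℚ) = M * q) : ‖(q : ℚ_[3])‖ ≤ 1 := by
  have hM1 : ‖((M : ℚ) : ℚ_[3])‖ = 1 := by
    have hcop : Nat.Coprime 3 M := (Nat.Prime.coprime_iff_not_dvd Nat.prime_three).mpr hM
    have := (Padic.norm_natCast_eq_one_iff (p := 3) (n := M)).mpr hcop
    exact_mod_cast this
  have hM0 : ((M : ℚ) : ℚ_[3]) ≠ 0 := fun h0 ↦ by rw [h0, norm_zero] at hM1; exact zero_ne_one hM1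
  have hq : (q : ℚ_[3]) = ((m : ℚ) : ℚ_[3]) / ((M : ℚ) : ℚ_[3]) := by
    rw [eq_div_iff hM0, ← Rat.cast_mul, show q * (M : ℚ) = m by rw [mul_comm]; exact h.symm]
  rw [hq, norm_div, hM1, div_one, Rat.cast_intCast]
  exact Padic.norm_int_le_one m

/-! ## §2 (INT)_K at a rational point -/

/-- **(INT)_K when `Y₀ ∈ ℚ`**: the renormalised cube root `g = ρ⁻¹h` is INTEGRAL (`K' = 0`), by p3 g15's
`MinimalCubeRoot.exists_int_minimalCubeRoot` read in `ℂ`. [cite: SilvermanAEC2009, VII.3.4 and IV.1 (shape)] -/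
theorem exists_algInt_minimalCubeRootC_of_ratCast (W : WeierstrassCurve ℚ) [W.IsElliptic] [W.IsGloballyMinimal] {N : ℕ} [NeZero N]
    (D : ModularParametrizationData W N) (a : ℕ → ℤ) (ha : ∀ n, (a n : ℂ) = cuspCoeff D.f n) (X₀ y : ℚ)
    (hT : IsShortThreeTorsionC W D.c X₀ (y : ℂ)) (z : ℚ⟦X⟧) (hz : IsParamGerm W D.c a z) (h : ℂ⟦X⟧)
    (hh3 : h ^ 3 = kummerCubeSeriesC W D.c X₀ (y : ℂ) z) (hh0 : constantCoeff h = -1) (hb : IsThreeAdicallyBoundedAlg h) :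
    ∃ (g : ℂ⟦X⟧) (K' : ℕ), (∀ n, IsIntegral ℤ ((3 : ℂ) ^ K' * coeff n g)) ∧ constantCoeff g = -1 ∧
      (D.c : ℂ) • (PowerSeries.map (algebraMap ℚ ℂ) z * g) =
        PowerSeries.map (algebraMap ℚ ℂ) (W.formalExp.subst ((D.c : ℚ) • lSeriesLog a)) * h := by
  set φ := algebraMap ℚ ℂ with hφ
  have hTq : IsShortThreeTorsion W D.c X₀ y := isShortThreeTorsion_of_ratCast hT
  set Θ := kummerCubeSeries W D.c X₀ y z with hΘ
  have hΘC : kummerCubeSeriesC W D.c X₀ (y : ℂ) z = PowerSeries.map φ Θ := kummerCubeSeriesC_ratCast W D.c X₀ y z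
  -- `Θ(0) = −1`
  have hΘ0 : constantCoeff Θ = -1 := by
    have h1 : constantCoeff (PowerSeries.map φ Θ) = -1 := by rw [← hΘC, ← hh3, map_pow, hh0]; norm_num
    rw [← coeff_zero_eq_constantCoeff_apply, coeff_map, coeff_zero_eq_constantCoeff_apply, hφ, eq_ratCast] at h1
    exact_mod_cast h1
  -- the rational cube root and `h = map h_ℚ`
  obtain ⟨hq, hq3, hq0⟩ := exists_cubeRoot_of_constantCoeff_eq_neg_one Θ hΘ0
  have hmap : PowerSeries.map φ hq = h := by
    refine cubeRoot_unique (by norm_num) ?_ ?_ ?_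
    · rw [← map_pow, hq3, ← hΘC, hh3]
    · rw [← coeff_zero_eq_constantCoeff_apply, coeff_map, coeff_zero_eq_constantCoeff_apply, hq0, hh0, map_neg, map_one]
    · rw [← coeff_zero_eq_constantCoeff_apply, coeff_map, coeff_zero_eq_constantCoeff_apply, hq0, map_neg, map_one]; norm_num
  -- `h_ℚ` is `3`-adically bounded
  have hbq : IsThreeAdicallyBounded hq := by
    obtain ⟨K, hK⟩ := hb
    refine ⟨K, fun n ↦ ?_⟩
    obtain ⟨M, hM3, hint⟩ := hK n
    rw [← hmap, coeff_map, hφ, eq_ratCast] at hint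
    have hint' : IsIntegral ℤ (((M * (3 ^ K * coeff n hq) : ℚ)) : ℂ) := by push_cast at hint ⊢; rw [← mul_assoc]; exact hint
    obtain ⟨m, hm⟩ := exists_intCast_eq_of_isIntegral hint'
    exact not_dvd_den_of_norm_ratCast_le_one (norm_le_one_of_mul_int hM3 hm)
  -- p3 g15's integral minimal cube root
  obtain ⟨gq, hgint, hg0, hgid, -⟩ := MinimalCubeRoot.exists_int_minimalCubeRoot W D a ha X₀ y hTq z hz hq hq3 hq0 hbq
  refine ⟨PowerSeries.map φ gq, 0, fun n ↦ ?_, ?_, ?_⟩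
  · rw [pow_zero, one_mul, coeff_map, hφ, eq_ratCast, ← Rat.coe_int_num_of_den_eq_one (hgint n), Rat.cast_intCast]
    exact isIntegral_algebraMap
  · rw [← coeff_zero_eq_constantCoeff_apply, coeff_map, coeff_zero_eq_constantCoeff_apply, hg0, map_neg, map_one]
  · have := congrArg (PowerSeries.map φ) hgid
    rw [smul_eq_C_mul, map_mul, map_mul, PowerSeries.map_C, map_mul, hmap, hφ, eq_ratCast] at this
    rw [smul_eq_C_mul, ← this]
    push_cast
    ring

end Summit.BirchSwinnertonDyer.BirchSwinnertonDyer.Theorems.ManinLocalTwoThree.MinimalCubeRootC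

end
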